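import Summits.ABC.ABC.Theorems.SoloBlindFormsEval
import HarnessLib

/-!
# Values of coprime binary forms: height from below, gcd from above (C4″ bridge, part 2)

Solo seat `solo-ABC-blind` (ideation tier, summit-directed), session 6.

Let `a, c ∈ ℤ[X]` be coprime over `ℚ`, `deg c = n ≥ 1`, `deg a ≤ n`, and write `A(u,v), C(u,v)`
for the values of the degree-`n` forms `a.homogenize n`, `c.homogenize n` at integers `u, v`.
Then there are constants `L, G ≥ 1` (depending on `a, c` only) such that for all coprime `u, v`
with `|u| ≤ v`, `0 < v`:

* `vⁿ ≤ L · max(|A(u,v)|, |C(u,v)|)`   (the image of `(u : v)` under `(A : C)` has height `≥ n·h − O(1)`);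
* `gcd(A(u,v), C(u,v)) ∣ G`.

(`forms_height_gcd_bound`.)  Proof: Bezout identities `s a + t c = 1` and `s' a + t' c = X^{2n−1}`
with `deg s, t, s', t' ≤ n − 1` (`exists_bezout_natDegree_le`, Sylvester-matrix surjectivity via
Euclidean division), cleared of denominators (`IsLocalization.integerNormalization`), homogenised in
degree `2n − 1` and evaluated: `S̃A + T̃C = D v^{2n−1}`, `S̃'A + T̃'C = D' u^{2n−1}`.

References: folklore (e.g. the proof of functoriality of heights under morphisms `ℙ¹ → ℙ¹`);
used on the seat's WALL.md (C4″) with Mason 1984 [Mason1984].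
-/

noncomputable section

open Polynomial Finset

namespace Summit.ABC.ABC.Theorems

/-- **Bezout with degree control.**  Over a field, if `p, q` are coprime, `deg q = n ≥ 1`,
`deg p ≤ n` and `deg r ≤ 2n − 1`, then `r = s p + t q` with `deg s, deg t ≤ n − 1`. [folklore] -/
theorem exists_bezout_natDegree_le {K : Type*} [Field K] {p q r : K[X]} {n : ℕ} (hn : 1 ≤ n)
    (hpq : IsCoprime p q) (hp : p.natDegree ≤ n) (hq : q.natDegree = n)
    (hr : r.natDegree ≤ 2 * n - 1) :
    ∃ s t : K[X], s.natDegree ≤ n - 1 ∧ t.natDegree ≤ n - 1 ∧ s * p + t * q = r := by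
  obtain ⟨s₀, t₀, h⟩ := hpq
  have hq0 : q ≠ 0 := by rintro rfl; simp at hq; omega
  obtain ⟨s, hs⟩ : ∃ s : K[X], s = r * s₀ % q := ⟨_, rfl⟩
  obtain ⟨t, ht⟩ : ∃ t : K[X], t = r * t₀ + r * s₀ / q * p := ⟨_, rfl⟩
  have hid : s * p + t * q = r := by
    calc s * p + t * q = (r * s₀ % q + q * (r * s₀ / q)) * p + r * (t₀ * q) := by rw [hs, ht]; ring
      _ = r * (s₀ * p + t₀ * q) := by rw [EuclideanDomain.mod_add_div]; ring
      _ = r := by rw [h, mul_one]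
  have hsdeg : s.natDegree ≤ n - 1 := by
    have : s.natDegree < q.natDegree := by
      rw [hs]; exact Polynomial.natDegree_mod_lt (r * s₀) (by omega)
    rw [hq] at this; omega
  refine ⟨s, t, hsdeg, ?_, hid⟩
  by_cases ht0 : t = 0
  · rw [ht0]; simp
  have h1 : (t * q).natDegree = t.natDegree + n := by rw [Polynomial.natDegree_mul ht0 hq0, hq]
  have h2 : (t * q).natDegree ≤ 2 * n - 1 := by
    have : t * q = r - s * p := by rw [← hid]; ring
    rw [this]
    refine (Polynomial.natDegree_sub_le _ _).trans (max_le hr ?_)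
    exact (Polynomial.natDegree_mul_le).trans (by omega)
  omega

/-- Integer version: for `a, c ∈ ℤ[X]` coprime over `ℚ` (`deg c = n ≥ 1`, `deg a ≤ n`) and
`deg r ≤ 2n − 1` there are `D ≠ 0` and `S, T ∈ ℤ[X]` of degree `≤ n − 1` with `S a + T c = D·r`.
[folklore] -/
theorem exists_int_bezout (a c : ℤ[X]) {n : ℕ} (hn : 1 ≤ n) (ha : a.natDegree ≤ n)
    (hc : c.natDegree = n)
    (hcop : IsCoprime (a.map (Int.castRingHom ℚ)) (c.map (Int.castRingHom ℚ)))
    (r : ℤ[X]) (hr : r.natDegree ≤ 2 * n - 1) :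
    ∃ (D : ℤ) (S T : ℤ[X]), D ≠ 0 ∧ S.natDegree ≤ n - 1 ∧ T.natDegree ≤ n - 1 ∧
      S * a + T * c = C D * r := by
  have hinj : Function.Injective (Int.castRingHom ℚ) := Int.cast_injective
  obtain ⟨s, t, hs, ht, hid⟩ := exists_bezout_natDegree_le (K := ℚ) (r := r.map (Int.castRingHom ℚ))
    hn hcop (by rw [natDegree_map_eq_of_injective hinj]; exact ha)
    (by rw [natDegree_map_eq_of_injective hinj, hc])
    (by rw [natDegree_map_eq_of_injective hinj]; exact hr)
  obtain ⟨d₁, hd₁, hS⟩ := IsLocalization.integerNormalization_spec (nonZeroDivisors ℤ) s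
  obtain ⟨d₂, hd₂, hT⟩ := IsLocalization.integerNormalization_spec (nonZeroDivisors ℤ) t
  set S := IsLocalization.integerNormalization (nonZeroDivisors ℤ) s
  set T := IsLocalization.integerNormalization (nonZeroDivisors ℤ) t
  have hd₁0 : d₁ ≠ 0 := nonZeroDivisors.ne_zero hd₁
  have hd₂0 : d₂ ≠ 0 := nonZeroDivisors.ne_zero hd₂
  rw [algebraMap_int_eq] at hS hT
  have hSdeg : S.natDegree ≤ n - 1 := by
    rw [← natDegree_map_eq_of_injective hinj S, hS]
    exact (natDegree_smul_le _ _).trans hs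
  have hTdeg : T.natDegree ≤ n - 1 := by
    rw [← natDegree_map_eq_of_injective hinj T, hT]
    exact (natDegree_smul_le _ _).trans ht
  refine ⟨d₁ * d₂, C d₂ * S, C d₁ * T, mul_ne_zero hd₁0 hd₂0,
    (natDegree_C_mul_le _ _).trans hSdeg, (natDegree_C_mul_le _ _).trans hTdeg, ?_⟩
  apply Polynomial.map_injective _ hinj
  simp only [Polynomial.map_add, Polynomial.map_mul, Polynomial.map_C]
  simp only [hS, hT, zsmul_eq_mul, eq_intCast, map_intCast, Int.cast_mul]
  rw [← hid]
  simp only [map_mul, map_intCast]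
  ring

/-- Evaluating a homogenised identity `S a + T c = R`. [folklore] -/
theorem eval_homogenize_identity {S T a c R : ℤ[X]} {m n : ℕ} (hS : S.natDegree ≤ m)
    (hT : T.natDegree ≤ m) (ha : a.natDegree ≤ n) (hc : c.natDegree ≤ n) (hid : S * a + T * c = R)
    (x : Fin 2 → ℤ) :
    MvPolynomial.eval x (S.homogenize m) * MvPolynomial.eval x (a.homogenize n) +
      MvPolynomial.eval x (T.homogenize m) * MvPolynomial.eval x (c.homogenize n) =
      MvPolynomial.eval x (R.homogenize (m + n)) := by
  rw [← hid, Polynomial.homogenize_add, Polynomial.homogenize_mul _ _ hS ha,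
    Polynomial.homogenize_mul _ _ hT hc, map_add, map_mul, map_mul]

/-- Value of the form of `C D · X^N` in degree `N`: `D u^N`. [folklore] -/
theorem eval_homogenize_C_mul_X_pow (D : ℤ) (N : ℕ) (u v : ℤ) :
    MvPolynomial.eval ![u, v] ((C D * X ^ N : ℤ[X]).homogenize N) = D * u ^ N := by
  rw [Polynomial.homogenize_C_mul, Polynomial.homogenize_X_pow (le_refl N)]
  simp

/-- **Height from below and gcd from above for the values of coprime forms.** [folklore] -/
theorem forms_height_gcd_bound (a c : ℤ[X]) {n : ℕ} (hn : 1 ≤ n) (ha : a.natDegree ≤ n)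
    (hc : c.natDegree = n)
    (hcop : IsCoprime (a.map (Int.castRingHom ℚ)) (c.map (Int.castRingHom ℚ))) :
    ∃ L G : ℕ, 0 < L ∧ 0 < G ∧ ∀ u v : ℤ, IsCoprime u v → |u| ≤ v → 0 < v →
      v ^ n ≤ (L : ℤ) * max |MvPolynomial.eval ![u, v] (a.homogenize n)|
                            |MvPolynomial.eval ![u, v] (c.homogenize n)| ∧
      Int.gcd (MvPolynomial.eval ![u, v] (a.homogenize n))
        (MvPolynomial.eval ![u, v] (c.homogenize n)) ∣ G := by
  -- the two Bezout identities
  obtain ⟨D, S, T, hD, hS, hT, hid⟩ := exists_int_bezout a c hn ha hc hcop 1 (by simp)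
  obtain ⟨D', S', T', hD', hS', hT', hid'⟩ := exists_int_bezout a c hn ha hc hcop (X ^ (2 * n - 1))
    (by simp)
  set NS : ℤ := ∑ k ∈ range (n - 1 + 1), |S.coeff k| with hNS
  set NT : ℤ := ∑ k ∈ range (n - 1 + 1), |T.coeff k| with hNT
  have hNS0 : 0 ≤ NS := Finset.sum_nonneg fun _ _ => abs_nonneg _
  have hNT0 : 0 ≤ NT := Finset.sum_nonneg fun _ _ => abs_nonneg _
  refine ⟨(NS + NT).toNat + 1, (D * D').natAbs, Nat.succ_pos _,
    Int.natAbs_pos.mpr (mul_ne_zero hD hD'), fun u v hcuv huv hv => ?_⟩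
  set A := MvPolynomial.eval ![u, v] (a.homogenize n) with hA
  set Cv := MvPolynomial.eval ![u, v] (c.homogenize n) with hCv
  have hmn : n - 1 + n = 2 * n - 1 := by omega
  -- evaluate the identities
  have e1 := eval_homogenize_identity hS hT ha hc.le hid ![u, v]
  have e2 := eval_homogenize_identity hS' hT' ha hc.le hid' ![u, v]
  rw [mul_one, hmn, eval_homogenize_C] at e1
  rw [hmn, eval_homogenize_C_mul_X_pow] at e2
  rw [← hA, ← hCv] at e1 e2
  constructor
  · -- height bound
    have bS := abs_eval_homogenize_le S (n - 1) huv
    have bT := abs_eval_homogenize_le T (n - 1) huv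
    rw [← hNS] at bS; rw [← hNT] at bT
    have hvpos : (0 : ℤ) < v ^ (n - 1) := pow_pos hv _
    have hM0 : 0 ≤ max |A| |Cv| := (abs_nonneg A).trans (le_max_left _ _)
    have key : |D| * v ^ (2 * n - 1) ≤ (NS + NT) * v ^ (n - 1) * max |A| |Cv| := by
      have : |D * v ^ (2 * n - 1)| = |D| * v ^ (2 * n - 1) := by
        rw [abs_mul, abs_pow, abs_of_pos hv]
      rw [← this, ← e1]
      refine (abs_add_le _ _).trans ?_
      rw [abs_mul, abs_mul]
      calc |MvPolynomial.eval ![u, v] (S.homogenize (n - 1))| * |A| +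
            |MvPolynomial.eval ![u, v] (T.homogenize (n - 1))| * |Cv|
          ≤ NS * v ^ (n - 1) * max |A| |Cv| + NT * v ^ (n - 1) * max |A| |Cv| :=
            add_le_add (mul_le_mul bS (le_max_left _ _) (abs_nonneg _) (mul_nonneg hNS0 hvpos.le))
              (mul_le_mul bT (le_max_right _ _) (abs_nonneg _) (mul_nonneg hNT0 hvpos.le))
        _ = (NS + NT) * v ^ (n - 1) * max |A| |Cv| := by ring
    have hD1 : 1 ≤ |D| := Int.one_le_abs hD
    have h2 : v ^ (2 * n - 1) = v ^ (n - 1) * v ^ n := by rw [← pow_add]; congr 1; omega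
    have key2 : v ^ (n - 1) * v ^ n ≤ v ^ (n - 1) * ((NS + NT) * max |A| |Cv|) := by
      rw [← h2]
      calc v ^ (2 * n - 1) ≤ |D| * v ^ (2 * n - 1) := le_mul_of_one_le_left (pow_nonneg hv.le _) hD1
        _ ≤ (NS + NT) * v ^ (n - 1) * max |A| |Cv| := key
        _ = v ^ (n - 1) * ((NS + NT) * max |A| |Cv|) := by ring
    have key3 := le_of_mul_le_mul_left key2 hvpos
    have hcast : (((NS + NT).toNat + 1 : ℕ) : ℤ) = NS + NT + 1 := by
      push_cast; rw [Int.toNat_of_nonneg (add_nonneg hNS0 hNT0)]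
    rw [hcast]
    nlinarith
  · -- gcd bound
    set g := Int.gcd A Cv with hg
    have hgA : (g : ℤ) ∣ A := Int.gcd_dvd_left (a := A) (b := Cv)
    have hgC : (g : ℤ) ∣ Cv := Int.gcd_dvd_right (a := A) (b := Cv)
    have h1 : (g : ℤ) ∣ D * D' * v ^ (2 * n - 1) := by
      have : (g : ℤ) ∣ D * v ^ (2 * n - 1) := by
        rw [← e1]; exact dvd_add (dvd_mul_of_dvd_right hgA _) (dvd_mul_of_dvd_right hgC _)
      rw [mul_comm D D', mul_assoc]; exact dvd_mul_of_dvd_right this _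
    have h2 : (g : ℤ) ∣ D * D' * u ^ (2 * n - 1) := by
      have : (g : ℤ) ∣ D' * u ^ (2 * n - 1) := by
        rw [← e2]; exact dvd_add (dvd_mul_of_dvd_right hgA _) (dvd_mul_of_dvd_right hgC _)
      rw [mul_assoc]; exact dvd_mul_of_dvd_right this _
    have h3 : (g : ℤ) ∣ (Int.gcd (D * D' * v ^ (2 * n - 1)) (D * D' * u ^ (2 * n - 1)) : ℤ) :=
      Int.dvd_coe_gcd h1 h2
    have hcop' : Int.gcd (v ^ (2 * n - 1)) (u ^ (2 * n - 1)) = 1 :=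
      Int.isCoprime_iff_gcd_eq_one.mp (IsCoprime.pow hcuv.symm)
    rw [Int.gcd_mul_left, hcop', mul_one] at h3
    exact Int.natCast_dvd_natCast.mp h3

end Summit.ABC.ABC.Theorems

end
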